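import Mathlib
import HarnessLib
import Summits.HubbardSuperconductivity.HubbardSuperconductivity.Theorems.KLProgrammeKLRegimeSplitSlotsV17F
import Summits.HubbardSuperconductivity.HubbardSuperconductivity.Theorems.KLProgrammeKLRegimeSplitSymInterpExact
import Summits.HubbardSuperconductivity.HubbardSuperconductivity.Theorems.KLProgrammeKLRegimeCountertermMuFlow
import Summits.HubbardSuperconductivity.HubbardSuperconductivity.Theorems.KLProgrammeKLRegimeEngineTwoLegStepV17FDoor
import Summits.HubbardSuperconductivity.HubbardSuperconductivity.Theorems.KLProgrammeKLRegimeTwoLegCurvatureDefs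

/-!
# Route `KLProgramme`, crux K3 — engine-flow child (stmt-HubbardSuperconductivity-20437 `KLRegimeEngineV17F2`), stub (C) `stub_twoLeg_curvature`:
# the renormalisation RESIDUE (P) of c4a-1's assembly SPLITS EXACTLY as (B) frame response + (C2) transport + (C1) Jackson remainder

Cell gate-hubbard-kl, seat hubbard-kl-k3c3-p3 (g6).  c4a-1's `…C4aReadJetAssembly` (p529260) reduces stub (C) at scale `n+1` to (A) the slice
increment at the new frame and (P) the k ≤ 4 jets of the PREVIOUS-scale reading AT THE NEW FRAME, `θ ↦ ν_n(K_{n+1})(θ) = klLocalPart … K_{n+1} n θ`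
(hypotheses `hPdiff`/`hP` of `twoLegReadJetBound_flow_succ`), «supplied by the doors».  This file is the model-level identity that fixes the doors'
currency, for ANY frame pair `K = K₀ ⊖ p` of degree `≤ L/2` (so for the flow `K₀ = K_n`, `p = klFlowPiece n`, `K = K_{n+1}` under the volume threshold
`4·klFlowDeg (n+1) ≤ L`, and verbatim for any re-keyed degree schedule):

  `ν_n(K)(θ) = [S_n(K) − S_n(K₀)](k_F^K(θ))`                                  — (B) the frame RESPONSE of the K-separated symbol (p2's door)
            `+ [ν̃_n(K₀)(k_F^K(θ)) − ν̃_n(K₀)(k_F^{K₀}(θ))]`                      — (C2) TRANSPORT of the old cumulative symbol between the two curves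
            `+ [ν_n(K₀)(θ) − p(k_F^K(θ))]`                                       — (C1) the old reading minus the piece on the new curve (JACKSON remainder)

where `S_n(K) := symInterp L (klLocSelfEnergyRe … K n − K∘p_·)` is the K-SEPARATED symbol (the self-energy of `𝒱^{(n)} − 𝒩_K`,
`klLocSelfEnergyRe_sub_frame_eq_locRe`), `ν̃_n(K₀) := symInterp L (klLocSelfEnergyRe … K₀ n)` the old cumulative symbol (so `ν̃_n(K₀)∘k_F^{K₀} = ν_n(K₀)`
by definition) and the frame parts are reproduced EXACTLY by the interpolant (`eval_symInterp_latticeValues_of_degree_le`, p1b/p2).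
* §1 `klLocalPart_eq_frame_add_sep` (`ν_n(K) = K∘k_F^K + S_n(K)∘k_F^K`), **`klLocalPart_residue_split`** (the three-term identity), its flow instance
  `klLocalPart_flow_residue_split` (degree guard `degree_klFlowFrameU_le` + `4·klFlowDeg (n+1) ≤ L`);
* §2 jets: **`readResidue_jets_of_doors`** — if the three brackets are `C⁴` in `θ` with `|∂_θ^k| ≤ B k, T k, J k` (`k ≤ 4`) then `θ ↦ ν_n(K)(θ)` is `C⁴` with
  `|∂_θ^k ν_n(K)| ≤ B k + T k + J k`; **`readResidue_flow_hP`** = exactly the pair (`hPdiff`, `hP`) of `twoLegReadJetBound_flow_succ` with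
  `curveJetBar (eB+eT+eJ) (eB'+eT'+eJ') U k (n+1)` when each door is stated in `curveJetBar` currency.
Identities + `iteratedDeriv_add` bookkeeping; nothing about the model's sizes is asserted.  BGM 2006 §2.2 (2.23) [cite: BenfattoGiulianiMastropietro2006].
-/

noncomputable section

namespace Summit.HubbardSuperconductivity.HubbardSuperconductivity.Theorems.KLRegimeSplit

set_option linter.dupNamespace false -- summit = problem name (single-conjunct summit), D-0017

open Real Literature.MathematicalPhysics.QuantumLattice Literature.Probability.LatticeModels
open Literature.MathematicalPhysics.QuantumLattice.FermiRG

section Model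

variable {L M : ℕ} [NeZero L] [NeZero M]

/-! ## §1 The value-level identities -/

/-- **Frame part + K-separated part**: for `K.degree ≤ L/2`, `ν_n(K)(θ) = K(k_F^K(θ)) + S_n(K)(k_F^K(θ))` with
`S_n(K) = symInterp L (klLocSelfEnergyRe … K n − K∘p)` (the interpolant reproduces the frame exactly). -/
theorem klLocalPart_eq_frame_add_sep (β U μ : ℝ) {K : TrigPolyC4v} (hK : K.degree ≤ L / 2) (n : ℕ) (θ : ℝ) :
    klLocalPart L M β U μ K n θ =
      K.eval (klFermiPoint μ K θ) +
        (symInterp L (fun k => klLocSelfEnergyRe L M β U μ K n k - K.eval (latticeMomentum L k))).eval (klFermiPoint μ K θ) := by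
  unfold klLocalPart
  rw [eval_symInterp_sub L, eval_symInterp_latticeValues_of_degree_le L K hK]
  ring

/-- **THE RESIDUE SPLIT (B) + (C2) + (C1)**: for frames `K₀`, `K = K₀ ⊖ p` of degree `≤ L/2`,
`ν_n(K)(θ) = [S_n(K) − S_n(K₀)](k_F^K θ) + [ν̃_n(K₀)(k_F^K θ) − ν_n(K₀)(θ)] + [ν_n(K₀)(θ) − p(k_F^K θ)]`. -/
theorem klLocalPart_residue_split (β U μ : ℝ) {K₀ p : TrigPolyC4v} (hK₀ : K₀.degree ≤ L / 2) (hK : (fsub K₀ p).degree ≤ L / 2) (n : ℕ) (θ : ℝ) :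
    klLocalPart L M β U μ (fsub K₀ p) n θ =
      ((symInterp L (fun k => klLocSelfEnergyRe L M β U μ (fsub K₀ p) n k - (fsub K₀ p).eval (latticeMomentum L k))).eval
            (klFermiPoint μ (fsub K₀ p) θ) -
          (symInterp L (fun k => klLocSelfEnergyRe L M β U μ K₀ n k - K₀.eval (latticeMomentum L k))).eval (klFermiPoint μ (fsub K₀ p) θ)) +
        ((symInterp L (klLocSelfEnergyRe L M β U μ K₀ n)).eval (klFermiPoint μ (fsub K₀ p) θ) - klLocalPart L M β U μ K₀ n θ) +
        (klLocalPart L M β U μ K₀ n θ - p.eval (klFermiPoint μ (fsub K₀ p) θ)) := by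
  rw [klLocalPart_eq_frame_add_sep β U μ hK n θ]
  -- the old cumulative symbol at the new Fermi point = `K₀ + S_n(K₀)` there (exact reproduction of `K₀`)
  have hold : (symInterp L (klLocSelfEnergyRe L M β U μ K₀ n)).eval (klFermiPoint μ (fsub K₀ p) θ) =
      K₀.eval (klFermiPoint μ (fsub K₀ p) θ) +
        (symInterp L (fun k => klLocSelfEnergyRe L M β U μ K₀ n k - K₀.eval (latticeMomentum L k))).eval (klFermiPoint μ (fsub K₀ p) θ) := by
    rw [eval_symInterp_sub L, eval_symInterp_latticeValues_of_degree_le L K₀ hK₀]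
    ring
  rw [hold, eval_fsub]
  ring

/-- The volume guard: `4·klFlowDeg (n+1) ≤ L` puts both flow frames `K_n`, `K_{n+1}` under the degree guard `≤ L/2`. -/
theorem degree_klFlowFrameU_le_half {β U μ : ℝ} {n : ℕ} (hL : 4 * klFlowDeg (n + 1) ≤ L) :
    (klFlowFrameU L M β U μ n).degree ≤ L / 2 ∧ (klFlowFrameU L M β U μ (n + 1)).degree ≤ L / 2 := by
  have h1 := EngineV8.degree_klFlowFrameU_le L M β U μ n
  have h2 := EngineV8.degree_klFlowFrameU_le L M β U μ (n + 1)
  have hmono : klFlowDeg n ≤ klFlowDeg (n + 1) := EngineV8.klFlowDeg_mono (Nat.le_succ n)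
  constructor <;> omega

/-- **The flow instance** (`K₀ = K_n`, `p = klFlowPiece n`, `K = K_{n+1}`), under the volume guard `4·klFlowDeg (n+1) ≤ L`. -/
theorem klLocalPart_flow_residue_split (β U μ : ℝ) {n : ℕ} (hL : 4 * klFlowDeg (n + 1) ≤ L) (θ : ℝ) :
    klLocalPart L M β U μ (klFlowFrameU L M β U μ (n + 1)) n θ =
      ((symInterp L (fun k => klLocSelfEnergyRe L M β U μ (klFlowFrameU L M β U μ (n + 1)) n k -
              (klFlowFrameU L M β U μ (n + 1)).eval (latticeMomentum L k))).eval (klFermiPoint μ (klFlowFrameU L M β U μ (n + 1)) θ) -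
          (symInterp L (fun k => klLocSelfEnergyRe L M β U μ (klFlowFrameU L M β U μ n) n k -
              (klFlowFrameU L M β U μ n).eval (latticeMomentum L k))).eval (klFermiPoint μ (klFlowFrameU L M β U μ (n + 1)) θ)) +
        ((symInterp L (klLocSelfEnergyRe L M β U μ (klFlowFrameU L M β U μ n) n)).eval (klFermiPoint μ (klFlowFrameU L M β U μ (n + 1)) θ) -
            klLocalPart L M β U μ (klFlowFrameU L M β U μ n) n θ) +
        (klLocalPart L M β U μ (klFlowFrameU L M β U μ n) n θ -
          (klFlowPiece L M β U μ n).eval (klFermiPoint μ (klFlowFrameU L M β U μ (n + 1)) θ)) := by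
  obtain ⟨h0, h1⟩ := degree_klFlowFrameU_le_half (L := L) (M := M) (β := β) (U := U) (μ := μ) hL
  rw [klFlowFrameU_succ] at h1 ⊢
  exact klLocalPart_residue_split β U μ h0 h1 n θ

/-! ## §2 Jets: the three doors add -/

/-- **Jets of the residue from the three doors** (generic frames): if (B), (C2), (C1) — as functions of `θ` — are `C⁴` with
`|∂_θ^k| ≤ B k`, `T k`, `J k` for `k ≤ 4`, then `θ ↦ ν_n(K₀ ⊖ p)(θ)` is `C⁴` with `|∂_θ^k| ≤ B k + T k + J k`. -/
theorem readResidue_jets_of_doors (β U μ : ℝ) {K₀ p : TrigPolyC4v} (hK₀ : K₀.degree ≤ L / 2) (hK : (fsub K₀ p).degree ≤ L / 2) (n : ℕ)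
    {B T J : ℕ → ℝ}
    (hBdiff : ContDiff ℝ 4 fun θ : ℝ =>
      (symInterp L (fun k => klLocSelfEnergyRe L M β U μ (fsub K₀ p) n k - (fsub K₀ p).eval (latticeMomentum L k))).eval
          (klFermiPoint μ (fsub K₀ p) θ) -
        (symInterp L (fun k => klLocSelfEnergyRe L M β U μ K₀ n k - K₀.eval (latticeMomentum L k))).eval (klFermiPoint μ (fsub K₀ p) θ))
    (hB : ∀ k ≤ 4, ∀ θ : ℝ, |iteratedDeriv k (fun θ : ℝ =>
      (symInterp L (fun k => klLocSelfEnergyRe L M β U μ (fsub K₀ p) n k - (fsub K₀ p).eval (latticeMomentum L k))).eval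
          (klFermiPoint μ (fsub K₀ p) θ) -
        (symInterp L (fun k => klLocSelfEnergyRe L M β U μ K₀ n k - K₀.eval (latticeMomentum L k))).eval (klFermiPoint μ (fsub K₀ p) θ)) θ| ≤ B k)
    (hTdiff : ContDiff ℝ 4 fun θ : ℝ =>
      (symInterp L (klLocSelfEnergyRe L M β U μ K₀ n)).eval (klFermiPoint μ (fsub K₀ p) θ) - klLocalPart L M β U μ K₀ n θ)
    (hT : ∀ k ≤ 4, ∀ θ : ℝ, |iteratedDeriv k (fun θ : ℝ =>
      (symInterp L (klLocSelfEnergyRe L M β U μ K₀ n)).eval (klFermiPoint μ (fsub K₀ p) θ) - klLocalPart L M β U μ K₀ n θ) θ| ≤ T k)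
    (hJdiff : ContDiff ℝ 4 fun θ : ℝ => klLocalPart L M β U μ K₀ n θ - p.eval (klFermiPoint μ (fsub K₀ p) θ))
    (hJ : ∀ k ≤ 4, ∀ θ : ℝ, |iteratedDeriv k (fun θ : ℝ => klLocalPart L M β U μ K₀ n θ - p.eval (klFermiPoint μ (fsub K₀ p) θ)) θ| ≤ J k) :
    ContDiff ℝ 4 (fun θ : ℝ => klLocalPart L M β U μ (fsub K₀ p) n θ) ∧
      ∀ k ≤ 4, ∀ θ : ℝ, |iteratedDeriv k (fun θ : ℝ => klLocalPart L M β U μ (fsub K₀ p) n θ) θ| ≤ B k + T k + J k := by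
  -- name the three brackets
  set fB : ℝ → ℝ := fun θ =>
      (symInterp L (fun k => klLocSelfEnergyRe L M β U μ (fsub K₀ p) n k - (fsub K₀ p).eval (latticeMomentum L k))).eval
          (klFermiPoint μ (fsub K₀ p) θ) -
        (symInterp L (fun k => klLocSelfEnergyRe L M β U μ K₀ n k - K₀.eval (latticeMomentum L k))).eval (klFermiPoint μ (fsub K₀ p) θ) with hfB
  set fT : ℝ → ℝ := fun θ =>
      (symInterp L (klLocSelfEnergyRe L M β U μ K₀ n)).eval (klFermiPoint μ (fsub K₀ p) θ) - klLocalPart L M β U μ K₀ n θ with hfT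
  set fJ : ℝ → ℝ := fun θ => klLocalPart L M β U μ K₀ n θ - p.eval (klFermiPoint μ (fsub K₀ p) θ) with hfJ
  have hsum : (fun θ : ℝ => klLocalPart L M β U μ (fsub K₀ p) n θ) = (fB + fT) + fJ := by
    funext θ
    simp only [Pi.add_apply, hfB, hfT, hfJ]
    exact klLocalPart_residue_split β U μ hK₀ hK n θ
  rw [hsum]
  have hBT : ContDiff ℝ 4 (fB + fT) := hBdiff.add hTdiff
  have hBTJ : ContDiff ℝ 4 (fB + fT + fJ) := hBT.add hJdiff
  refine ⟨hBTJ, fun k hk θ => ?_⟩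
  have hk' : (k : WithTop ℕ∞) ≤ 4 := by exact_mod_cast hk
  rw [iteratedDeriv_add (hBT.contDiffAt.of_le hk') (hJdiff.contDiffAt.of_le hk'),
    iteratedDeriv_add (hBdiff.contDiffAt.of_le hk') (hTdiff.contDiffAt.of_le hk')]
  calc |iteratedDeriv k fB θ + iteratedDeriv k fT θ + iteratedDeriv k fJ θ|
      ≤ |iteratedDeriv k fB θ + iteratedDeriv k fT θ| + |iteratedDeriv k fJ θ| := abs_add_le _ _
    _ ≤ (|iteratedDeriv k fB θ| + |iteratedDeriv k fT θ|) + |iteratedDeriv k fJ θ| := by gcongr; exact abs_add_le _ _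
    _ ≤ B k + T k + J k := add_le_add (add_le_add (hB k hk θ) (hT k hk θ)) (hJ k hk θ)

/-- Three `curveJetBar` tables add. -/
theorem curveJetBar_add_three (b b' t t' j j' : ℕ → ℝ) (U : ℝ) (k n : ℕ) :
    curveJetBar b b' U k n + curveJetBar t t' U k n + curveJetBar j j' U k n =
      curveJetBar (fun k => b k + t k + j k) (fun k => b' k + t' k + j' k) U k n := by
  simp only [curveJetBar]
  ring

/-- **The flow instance in `curveJetBar` currency** — exactly the hypotheses `hPdiff`, `hP` of c4a-1's `twoLegReadJetBound_flow_succ` at scale `n+1`: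
given the (B) door with table `(eB, eB')`, the (C2) door with `(eT, eT')` and the (C1) door with `(eJ, eJ')` (all at the allowance scale `n+1`), under
the volume guard `4·klFlowDeg (n+1) ≤ L`. -/
theorem readResidue_flow_hP (β U μ : ℝ) {n : ℕ} (hL : 4 * klFlowDeg (n + 1) ≤ L) {eB eB' eT eT' eJ eJ' : ℕ → ℝ}
    (hBdiff : ContDiff ℝ 4 fun θ : ℝ =>
      (symInterp L (fun k => klLocSelfEnergyRe L M β U μ (klFlowFrameU L M β U μ (n + 1)) n k -
            (klFlowFrameU L M β U μ (n + 1)).eval (latticeMomentum L k))).eval (klFermiPoint μ (klFlowFrameU L M β U μ (n + 1)) θ) -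
        (symInterp L (fun k => klLocSelfEnergyRe L M β U μ (klFlowFrameU L M β U μ n) n k -
            (klFlowFrameU L M β U μ n).eval (latticeMomentum L k))).eval (klFermiPoint μ (klFlowFrameU L M β U μ (n + 1)) θ))
    (hB : ∀ k ≤ 4, ∀ θ : ℝ, |iteratedDeriv k (fun θ : ℝ =>
      (symInterp L (fun k => klLocSelfEnergyRe L M β U μ (klFlowFrameU L M β U μ (n + 1)) n k -
            (klFlowFrameU L M β U μ (n + 1)).eval (latticeMomentum L k))).eval (klFermiPoint μ (klFlowFrameU L M β U μ (n + 1)) θ) -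
        (symInterp L (fun k => klLocSelfEnergyRe L M β U μ (klFlowFrameU L M β U μ n) n k -
            (klFlowFrameU L M β U μ n).eval (latticeMomentum L k))).eval (klFermiPoint μ (klFlowFrameU L M β U μ (n + 1)) θ)) θ| ≤
      curveJetBar eB eB' U k (n + 1))
    (hTdiff : ContDiff ℝ 4 fun θ : ℝ =>
      (symInterp L (klLocSelfEnergyRe L M β U μ (klFlowFrameU L M β U μ n) n)).eval (klFermiPoint μ (klFlowFrameU L M β U μ (n + 1)) θ) -
        klLocalPart L M β U μ (klFlowFrameU L M β U μ n) n θ)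
    (hT : ∀ k ≤ 4, ∀ θ : ℝ, |iteratedDeriv k (fun θ : ℝ =>
      (symInterp L (klLocSelfEnergyRe L M β U μ (klFlowFrameU L M β U μ n) n)).eval (klFermiPoint μ (klFlowFrameU L M β U μ (n + 1)) θ) -
        klLocalPart L M β U μ (klFlowFrameU L M β U μ n) n θ) θ| ≤ curveJetBar eT eT' U k (n + 1))
    (hJdiff : ContDiff ℝ 4 fun θ : ℝ => klLocalPart L M β U μ (klFlowFrameU L M β U μ n) n θ -
      (klFlowPiece L M β U μ n).eval (klFermiPoint μ (klFlowFrameU L M β U μ (n + 1)) θ))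
    (hJ : ∀ k ≤ 4, ∀ θ : ℝ, |iteratedDeriv k (fun θ : ℝ => klLocalPart L M β U μ (klFlowFrameU L M β U μ n) n θ -
      (klFlowPiece L M β U μ n).eval (klFermiPoint μ (klFlowFrameU L M β U μ (n + 1)) θ)) θ| ≤ curveJetBar eJ eJ' U k (n + 1)) :
    ContDiff ℝ 4 (fun θ : ℝ => klLocalPart L M β U μ (klFlowFrameU L M β U μ (n + 1)) n θ) ∧
      ∀ k ≤ 4, ∀ θ : ℝ, |iteratedDeriv k (fun θ : ℝ => klLocalPart L M β U μ (klFlowFrameU L M β U μ (n + 1)) n θ) θ| ≤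
        curveJetBar (fun k => eB k + eT k + eJ k) (fun k => eB' k + eT' k + eJ' k) U k (n + 1) := by
  obtain ⟨h0, h1⟩ := degree_klFlowFrameU_le_half (L := L) (M := M) (β := β) (U := U) (μ := μ) hL
  rw [klFlowFrameU_succ] at h1 hBdiff hB hTdiff hT hJdiff hJ ⊢
  have h := readResidue_jets_of_doors β U μ h0 h1 n hBdiff hB hTdiff hT hJdiff hJ
  refine ⟨h.1, fun k hk θ => ?_⟩
  rw [← curveJetBar_add_three]
  exact h.2 k hk θ

end Model

end Summit.HubbardSuperconductivity.HubbardSuperconductivity.Theorems.KLRegimeSplit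

end
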